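import Summits.ResolutionOfSingularities.ResolutionOfSingularities.Theorems.EquisingularLiftEquisingularLiftNatNDChartPlays
import Mathlib.Algebra.MvPolynomial.Division
import Mathlib.RingTheory.Spectrum.Prime.Topology
import HarnessLib

/-!
# [OURS · L1 W4.5(b) · EL♮(3) · ND-K5 (B4α1)] THE STRICT TRANSFORM `toricStrict B g` IS COPRIME TO EVERY CHART VARIABLE

WIDTH helper for the ND-K5 bricks (B4α1i) `modelInit` / (B4α1s) `modelStep` (res-L1-w45b-idea-1's spec §13.14 `ND.ToricStage`, chart clause
`c ⁻¹' T = zeroLocus {toricStrict B g}`), `--supports stmt-ResolutionOfSingularities-20148`, no claim, counted 0 (res-L1-w45b-stub-4 g11).  AI-produced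
kernel work weaker than expert review; no statement of [Hironaka2017] is used; EL♮(3) is NOT proved here.

WHAT (over res-L1-w45b-lead-2's chart dictionary `…NatNDChartPullback`).  On a smooth chart (chart exponents injective on the table) the strict exponents
are injective on the table (`strictExp_injOn`), so the strict transform has the original coefficients at the strict exponents
(`coeff_toricStrict_strictExp`) and **no chart variable divides `toricStrict B g`** (`not_X_dvd_toricStrict`: the table member minimising `⟨B i, ·⟩`
gives a monomial free of `y_i`) — the input of the closure lemma `closure_zeroLocus_diff_zeroLocus_of_not_dvd` (`…NatNDAffineDictionary`); on a convenient
table the exceptional exponent of a FRAME row vanishes (`hVec_eq_zero_of_frameRow`, `n ≥ 2`), the single-exponent exceptional monomial is a power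
(`monomial_toFs_single`), and then off the exceptional variable the pull-back `g(y^B)` and `toricStrict B g` cut out the same set (`zeroLocus_chartPull_diff_eq`).
-/

set_option linter.dupNamespace false

noncomputable section

open MvPolynomial

namespace Summit.ResolutionOfSingularities.ResolutionOfSingularities.Cruxes.EquisingularLiftNat.Sections.ND

variable {n : ℕ} {k : Type} [Field k]

/-- Strict-transform exponents are injective on the table whenever chart exponents are. [OURS · ND chart dictionary] -/
theorem strictExp_injOn (B : Fin n → Fin n → ℕ) (V : Finset (Fin n → ℕ)) (hinj : Set.InjOn (chartExp B) V) :
    Set.InjOn (strictExp B V) V := by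
  intro m hm m' hm' h
  refine hinj hm hm' ?_
  funext i
  rw [← strictExp_add_hminN B hm i, ← strictExp_add_hminN B hm' i, h]

/-- The coefficient of the strict transform at the strict exponent of a support monomial is the original coefficient (smooth chart). [OURS · ND chart dictionary] -/
theorem coeff_toricStrict_strictExp (B : Fin n → Fin n → ℕ) (g : MvPolynomial (Fin n) k) (hinj : Set.InjOn (chartExp B) (table g))
    {d : Fin n →₀ ℕ} (hd : d ∈ g.support) :
    coeff (toFs (strictExp B (table g) ⇑d)) (toricStrict B g) = coeff d g := by
  classical
  unfold toricStrict
  rw [coeff_sum, Finset.sum_eq_single d]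
  · rw [coeff_monomial, if_pos rfl]
  · intro d' hd' hne
    rw [coeff_monomial, if_neg]
    intro h
    apply hne
    have h' := congrArg (fun v : Fin n →₀ ℕ => (⇑v : Fin n → ℕ)) h
    simp only [coe_toFs] at h'
    have := strictExp_injOn B (table g) hinj (coe_mem_table hd') (coe_mem_table hd) h'
    exact Finsupp.ext fun i => congrFun this i
  · intro h; exact absurd hd h

/-- **No chart variable divides the strict transform** (smooth chart, `g ≠ 0`): the table member minimising `⟨B i, ·⟩` gives a monomial of
`toricStrict B g` free of `y_i`. [OURS · ND chart dictionary] -/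
theorem not_X_dvd_toricStrict (B : Fin n → Fin n → ℕ) (g : MvPolynomial (Fin n) k) (hinj : Set.InjOn (chartExp B) (table g)) (hg : g ≠ 0) (i : Fin n) :
    ¬ (X i : MvPolynomial (Fin n) k) ∣ toricStrict B g := by
  classical
  rintro ⟨q, hq⟩
  obtain ⟨m, hm, hmin⟩ := exists_pairN_eq_hminN (table_nonempty hg) (B i)
  obtain ⟨d, hd, rfl⟩ : ∃ d ∈ g.support, (⇑d : Fin n → ℕ) = m := by
    rw [mem_table_iff] at hm; exact ⟨toFs m, hm, coe_toFs m⟩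
  have hcoeff := coeff_toricStrict_strictExp B g hinj hd
  have hzero : strictExp B (table g) ⇑d i = 0 := by
    unfold strictExp; rw [hmin, Nat.sub_self]
  rw [hq, coeff_X_mul', if_neg] at hcoeff
  · exact (mem_support_iff.mp hd) hcoeff.symm
  · rw [Finsupp.mem_support_iff, toFs_apply, hzero]; exact fun h => h rfl

/-- On a convenient table (`n ≥ 2`), the exceptional exponent of a FRAME row `B i = indicator of l₀` vanishes: the pure power of another variable
minimises `⟨e_{l₀}, ·⟩` at `0`. [OURS · ND chart dictionary] -/
theorem hVec_eq_zero_of_frameRow {V : Finset (Fin n → ℕ)} (hV : IsConvenientTable V) (B : Fin n → Fin n → ℕ) {i l₀ l₁ : Fin n} (hl : l₁ ≠ l₀)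
    (hrow : B i = fun l => if l = l₀ then 1 else 0) : hVec B V i = 0 := by
  obtain ⟨v, hv, -, hv0⟩ := hV.2 l₁
  have hle := hminN_le (V := V) (B i) hv
  have hpair : pairN (B i) v = 0 := by
    unfold pairN
    refine Finset.sum_eq_zero fun l _ => ?_
    rw [hrow]
    by_cases hl' : l = l₀
    · subst hl'; simp only [if_true]; rw [hv0 l hl.symm, mul_zero]
    · simp only [if_neg hl', zero_mul]
  unfold hVec
  exact Nat.le_zero.mp (hpair ▸ hle)

/-- The exceptional monomial with a single non-zero exponent is a power of that variable. [OURS · elementary] -/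
theorem monomial_toFs_single (h : Fin n → ℕ) (j : Fin n) (hz : ∀ i, i ≠ j → h i = 0) :
    (monomial (toFs h) (1 : k)) = X j ^ h j := by
  have : toFs h = Finsupp.single j (h j) := by
    ext i
    rw [toFs_apply, Finsupp.single_apply]
    by_cases hij : i = j
    · subst hij; rw [if_pos rfl]
    · rw [if_neg (Ne.symm hij), hz i hij]
  rw [this, X_pow_eq_monomial]

/-- **The chart hypersurface off the exceptional variable**: if the exceptional exponents of all rows but `j` vanish, then off `V(y_j)` the pull-back
`g(y^B)` and the strict transform `toricStrict B g` cut out the same set. [OURS · ND chart dictionary] -/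
theorem zeroLocus_chartPull_diff_eq (B : Fin n → Fin n → ℕ) (g : MvPolynomial (Fin n) k) (j : Fin n) (hz : ∀ i, i ≠ j → hVec B (table g) i = 0) :
    PrimeSpectrum.zeroLocus {chartPull B g} \ PrimeSpectrum.zeroLocus {(X j : MvPolynomial (Fin n) k)} =
      PrimeSpectrum.zeroLocus {toricStrict B g} \ PrimeSpectrum.zeroLocus {(X j : MvPolynomial (Fin n) k)} := by
  ext p
  simp only [Set.mem_sdiff, PrimeSpectrum.mem_zeroLocus, Set.singleton_subset_iff, SetLike.mem_coe]
  rw [chartPull_eq, monomial_toFs_single _ j hz]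
  constructor
  · rintro ⟨h1, h2⟩
    refine ⟨?_, h2⟩
    rcases p.2.mem_or_mem h1 with h | h
    · exact absurd (p.2.mem_of_pow_mem _ h) h2
    · exact h
  · rintro ⟨h1, h2⟩
    exact ⟨Ideal.mul_mem_left _ _ h1, h2⟩

end Summit.ResolutionOfSingularities.ResolutionOfSingularities.Cruxes.EquisingularLiftNat.Sections.ND

end
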